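import Summits.AnomalousDissipation.AnomalousDissipation.Theorems.MarginalStabilityChainChainRealisationStubCompactLimitsOfShiftsB
import Literature.Analysis.FluidPDE.TorusWordEnergy
import HarnessLib

/-!
# Stub `stub_compactLimitsOfShifts` of the line `SketchIdeator2` (card `separatrix-flux-pinning`)
# (crux stmt-AnomalousDissipation-14249, `MarginalStabilityChain.ChainRealisation`) — part C and
# assembly

**Compact limits of shifts.**  Granting the registered stubs `stub_liftBounds` (all space–time
derivatives of the lifts of a forward classical Navier–Stokes solution with all-order Sobolev bounds
are bounded on `(0,∞) × ℝ³`) and `stub_ascoliSmooth` (Arzelà–Ascoli with all derivatives on an open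
half-space) as hypotheses — verbatim their registered statements — every sequence of forward
time-translates `u(sₙ + ·)`, `sₙ ≥ 0`, of a forward classical mean-zero solution `u` on
`[0,∞) × T³` (steady smooth solenoidal mean-zero force, `ν > 0`) with `sup_{t ≥ 0} E_k(u(t)) < ∞` for
all `k` has a subsequence converging, in `L²(T³)` and in `H¹` uniformly on every `[0,T]`, to a
forward classical mean-zero solution of the same system (`stub_compactLimitsOfShifts`).

* bounded `sₙ` (`clsC_compactLimit_of_bounded`): Bolzano–Weierstrass `s_{φ n} → s⋆`, limit
  `u(· + s⋆)` (time-translation invariance `IsClassicalNSSolutionOn.comp_add_const`), convergence by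
  uniform continuity of `stLift u` and of `D_{[0,∞)×ℝ³}(stLift u)` on `[0, T+R] × (unit cube)`;
* unbounded `sₙ`: a subsequence with `sₙ ≥ 1`, then part B (`clsB_compactLimit_of_unbounded`).

References: C. Foias, O. Manley, R. Rosa, R. Temam, *Navier–Stokes Equations and Turbulence*,
CUP 2001, Ch. III §2.
-/

set_option linter.dupNamespace false

noncomputable section

open MeasureTheory Set Filter Topology
open scoped InnerProductSpace
open Literature.Analysis.FunctionSpaces Literature.Analysis.FunctionSpaces.Torus
open Literature.Analysis.FluidPDE Literature.Analysis.FluidPDE.Torus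

namespace Summit.AnomalousDissipation.AnomalousDissipation.Theorems.ChainRealisation.SeparatrixFluxPinning

/-! ## §C.1 Bounded sequences of translates -/

/-- **Compact limits of bounded sequences of translates**: if `0 ≤ sₙ ≤ R`, a subsequence
`s_{φ n} → s⋆` and the translates `u(· + s_{φ n})` converge to `u(· + s⋆)` in `L²` and `H¹`
uniformly on every `[0,T]` (uniform continuity of the lift and of its first derivative on
compacts). -/
theorem clsC_compactLimit_of_bounded {ν : ℝ} {F : UnitAddTorus (Fin 3) → EuclideanSpace ℝ (Fin 3)}
    {u : ℝ → UnitAddTorus (Fin 3) → EuclideanSpace ℝ (Fin 3)} {p : ℝ → UnitAddTorus (Fin 3) → ℝ}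
    (hsol : IsClassicalNSSolutionOn (Ici 0) ν (fun _ => F) u p)
    (hzm : ∀ t : ℝ, 0 ≤ t → HasZeroMean (u t))
    {s : ℕ → ℝ} (hs0 : ∀ n, 0 ≤ s n) {R : ℝ} (hsR : ∀ n, s n ≤ R) :
    ∃ φ : ℕ → ℕ, StrictMono φ ∧
      ∃ (v : ℝ → UnitAddTorus (Fin 3) → EuclideanSpace ℝ (Fin 3)) (q : ℝ → UnitAddTorus (Fin 3) → ℝ),
        IsClassicalNSSolutionOn (Ici 0) ν (fun _ => F) v q ∧ (∀ t : ℝ, 0 ≤ t → HasZeroMean (v t)) ∧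
        ∀ T ε : ℝ, 0 ≤ T → 0 < ε → ∀ᶠ n in atTop, ∀ t ∈ Icc 0 T,
          (∫ x, ‖u (t + s (φ n)) x - v t x‖ ^ 2) ≤ ε ∧
            gradNormSq (fun x => u (t + s (φ n)) x - v t x) ≤ ε := by
  -- Bolzano–Weierstrass
  obtain ⟨a, ha, φ, hφ, hlim⟩ := tendsto_subseq_of_bounded (Metric.isBounded_Icc 0 R)
    (fun n => (⟨hs0 n, hsR n⟩ : s n ∈ Icc 0 R))
  rw [closure_Icc] at ha
  have ha0 : 0 ≤ a := ha.1
  -- the limit trajectory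
  set v : ℝ → UnitAddTorus (Fin 3) → EuclideanSpace ℝ (Fin 3) := fun t => u (t + a) with hv
  set q : ℝ → UnitAddTorus (Fin 3) → ℝ := fun t => p (t + a) with hq
  have hshift_sol : ∀ c : ℝ, 0 ≤ c →
      IsClassicalNSSolutionOn (Ici 0) ν (fun _ => F) (fun t => u (t + c)) (fun t => p (t + c)) := by
    intro c hc
    have h := hsol.comp_add_const c
    have hpre : Ici (0 : ℝ) ⊆ (· + c) ⁻¹' Ici 0 := fun t (ht : 0 ≤ t) => by
      show 0 ≤ t + c; linarith
    exact h.mono hpre (uniqueDiffOn_Ici 0)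
  have hclass : IsClassicalNSSolutionOn (Ici 0) ν (fun _ => F) v q := hshift_sol a ha0
  have hzmv : ∀ t : ℝ, 0 ≤ t → HasZeroMean (v t) := fun t ht => hzm _ (by positivity)
  refine ⟨φ, hφ, v, q, hclass, hzmv, ?_⟩
  intro T ε hT hε
  -- the compact set and uniform continuity there
  set D : Set (ℝ × EuclideanSpace ℝ (Fin 3)) := Ici 0 ×ˢ univ with hD
  have hU : UniqueDiffOn ℝ D := (uniqueDiffOn_Ici 0).prod uniqueDiffOn_univ
  set C3 : Set (EuclideanSpace ℝ (Fin 3)) :=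
    (WithLp.toLp 2) '' (Set.pi univ fun _ : Fin 3 => Icc (0 : ℝ) 1) with hC3
  set K : Set (ℝ × EuclideanSpace ℝ (Fin 3)) := Icc 0 (T + R) ×ˢ C3 with hK
  have hKc : IsCompact K := isCompact_Icc.prod isCompact_toLp_image_pi_Icc
  have hKD : K ⊆ D := prod_mono (fun t ht => ht.1) (subset_univ _)
  have hsm : IsSmoothSpaceTimeOn (Ici 0) u := hsol.smooth_velocity
  have hΦ₀ : ContinuousOn (stLift u) K := hsm.continuousOn_stLift.mono hKD
  have hΦ₁ : ContinuousOn (fun z => fderivWithin ℝ (stLift u) D z) K :=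
    ((hsm.fderivWithin hU (m := 0) (by norm_num)).continuousOn).mono hKD
  obtain ⟨δ, hδ, hδε⟩ : ∃ δ : ℝ, 0 < δ ∧ 3 * δ ^ 2 ≤ ε := by
    refine ⟨Real.sqrt (ε / 3), Real.sqrt_pos.2 (by positivity), ?_⟩
    rw [Real.sq_sqrt (by positivity)]
    linarith
  obtain ⟨η₀, hη₀, hη₀'⟩ := Metric.uniformContinuousOn_iff.1 (hKc.uniformContinuousOn_of_continuous hΦ₀) δ hδ
  obtain ⟨η₁, hη₁, hη₁'⟩ := Metric.uniformContinuousOn_iff.1 (hKc.uniformContinuousOn_of_continuous hΦ₁) δ hδ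
  have hη : 0 < min η₀ η₁ := lt_min hη₀ hη₁
  have hev : ∀ᶠ n in atTop, dist (s (φ n)) a < min η₀ η₁ :=
    (Metric.tendsto_nhds.1 hlim) _ hη
  filter_upwards [hev] with n hn
  intro t ht
  have ht0 : (0 : ℝ) ≤ t := ht.1
  have hsn : s (φ n) ∈ Icc 0 R := ⟨hs0 _, hsR _⟩
  -- the two points of `K` over `x`
  have hmem : ∀ (c : ℝ), c ∈ Icc 0 R → ∀ x : UnitAddTorus (Fin 3),
      ((t + c, repr x) : ℝ × EuclideanSpace ℝ (Fin 3)) ∈ K := fun c hc x =>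
    mk_mem_prod ⟨by linarith [hc.1], by linarith [hc.2, ht.2]⟩ (repr_mem_toLp_image_pi_Icc x)
  have hdist : ∀ x : UnitAddTorus (Fin 3),
      dist ((t + s (φ n), repr x) : ℝ × EuclideanSpace ℝ (Fin 3)) (t + a, repr x) < min η₀ η₁ := by
    intro x
    rw [Prod.dist_eq, dist_self, max_eq_left dist_nonneg, Real.dist_eq]
    rw [Real.dist_eq] at hn
    have : t + s (φ n) - (t + a) = s (φ n) - a := by ring
    rwa [this]
  have hsm1 : IsSmooth (u (t + s (φ n))) := hsm.isSmooth_slice (mem_Ici.2 (by linarith [hs0 (φ n)]))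
  have hsm2 : IsSmooth (v t) := hclass.smooth_velocity.isSmooth_slice (mem_Ici.2 ht0)
  -- order 0
  have hpt : ∀ x, ‖u (t + s (φ n)) x - v t x‖ ≤ δ := by
    intro x
    have h := hη₀' _ (hmem _ hsn x) _ (hmem _ ha x) ((hdist x).trans_le (min_le_left _ _))
    rw [dist_eq_norm] at h
    have e1 : u (t + s (φ n)) x = stLift u (t + s (φ n), repr x) := by simp [stLift]
    have e2 : v t x = stLift u (t + a, repr x) := by simp [hv, stLift]
    rw [e1, e2]
    exact h.le
  -- order 1
  have hpt1 : ∀ i x, ‖partialDeriv i (u (t + s (φ n))) x - partialDeriv i (v t) x‖ ≤ δ := by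
    intro i x
    have h := hη₁' _ (hmem _ hsn x) _ (hmem _ ha x) ((hdist x).trans_le (min_le_right _ _))
    rw [dist_eq_norm] at h
    set w : ℝ × EuclideanSpace ℝ (Fin 3) := (0, EuclideanSpace.single i 1) with hw
    have e1 : partialDeriv i (u (t + s (φ n))) x = fderivWithin ℝ (stLift u) D (t + s (φ n), repr x) w := by
      have h := clsA_partialDeriv_slice_eq hsm (t := t + s (φ n)) (mem_Ici.2 (by linarith [hs0 (φ n)])) (repr x) i
      rwa [proj_repr] at h
    have e2 : partialDeriv i (v t) x = fderivWithin ℝ (stLift u) D (t + a, repr x) w := by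
      have h := clsA_partialDeriv_slice_eq hsm (t := t + a) (mem_Ici.2 (by linarith)) (repr x) i
      rw [proj_repr] at h
      exact h
    have hwn : ‖w‖ ≤ 1 := by
      rw [hw, Prod.norm_def]
      simp
    have hsub : fderivWithin ℝ (stLift u) D (t + s (φ n), repr x) w - fderivWithin ℝ (stLift u) D (t + a, repr x) w =
        (fderivWithin ℝ (stLift u) D (t + s (φ n), repr x) - fderivWithin ℝ (stLift u) D (t + a, repr x)) w := by
      simp
    rw [e1, e2, hsub]
    calc ‖(fderivWithin ℝ (stLift u) D (t + s (φ n), repr x) - fderivWithin ℝ (stLift u) D (t + a, repr x)) w‖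
        ≤ ‖fderivWithin ℝ (stLift u) D (t + s (φ n), repr x) - fderivWithin ℝ (stLift u) D (t + a, repr x)‖ * ‖w‖ :=
          ContinuousLinearMap.le_opNorm _ _
      _ ≤ δ * 1 := mul_le_mul h.le hwn (norm_nonneg _) hδ.le
      _ = δ := mul_one δ
  refine ⟨(clsA_integral_norm_sub_sq_le hpt).trans (by nlinarith), ?_⟩
  exact (clsA_gradNormSq_sub_le hsm1 hsm2 hpt1).trans hδε

/-! ## §C.2 Assembly: the registered stub -/

/-- **Stub B5 `stub_compactLimitsOfShifts` (COMPACT LIMITS OF SHIFTS).**  Granting the registered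
statements of `stub_liftBounds` and `stub_ascoliSmooth` (hypotheses, verbatim), every sequence of
forward time-translates `u(sₙ + ·)` (`sₙ ≥ 0`) of a forward classical mean-zero Navier–Stokes
solution on `[0,∞) × T³` with all-order Sobolev bounds (steady smooth solenoidal mean-zero force,
`ν > 0`) has a subsequence converging — in `L²` and in `H¹`, uniformly on every `[0,T]` — to a forward
classical mean-zero solution of the same system.  Bounded `sₙ`: `clsC_compactLimit_of_bounded`;
unbounded: along a subsequence with `sₙ ≥ 1`, `clsB_compactLimit_of_unbounded`. -/
theorem stub_compactLimitsOfShifts :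
    (∀ (ν : ℝ) (F : UnitAddTorus (Fin 3) → EuclideanSpace ℝ (Fin 3))
      (u : ℝ → UnitAddTorus (Fin 3) → EuclideanSpace ℝ (Fin 3)) (p : ℝ → UnitAddTorus (Fin 3) → ℝ),
      0 < ν → IsSmooth F → IsDivFree F → HasZeroMean F →
      IsClassicalNSSolutionOn (Set.Ici 0) ν (fun _ => F) u p →
      (∀ t : ℝ, 0 ≤ t → HasZeroMean (u t)) →
      (∀ k : ℕ, ∃ C : ℝ, ∀ t : ℝ, 0 ≤ t → sobolevEnergy k (u t) ≤ C) →
      (∀ m : ℕ, ∃ C : ℝ, ∀ z ∈ Set.Ioi (0 : ℝ) ×ˢ (Set.univ : Set (EuclideanSpace ℝ (Fin 3))),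
          ‖iteratedFDeriv ℝ m (stLift u) z‖ ≤ C) ∧
      (∀ m : ℕ, ∃ C : ℝ, ∀ z ∈ Set.Ioi (0 : ℝ) ×ˢ (Set.univ : Set (EuclideanSpace ℝ (Fin 3))),
          ‖iteratedFDeriv ℝ m (stLift (fun t x => p t x - p t 0)) z‖ ≤ C)) →
    (∀ {G : Type} [NormedAddCommGroup G] [NormedSpace ℝ G] [FiniteDimensional ℝ G]
      (a : ℝ) (f : ℕ → ℝ × EuclideanSpace ℝ (Fin 3) → G),
      (∀ n, ContDiffOn ℝ (⊤ : ℕ∞) (f n) (Set.Ioi a ×ˢ Set.univ)) →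
      (∀ m : ℕ, ∃ C : ℝ, ∀ n, ∀ z ∈ Set.Ioi a ×ˢ (Set.univ : Set (EuclideanSpace ℝ (Fin 3))),
          ‖iteratedFDeriv ℝ m (f n) z‖ ≤ C) →
      ∃ φ : ℕ → ℕ, StrictMono φ ∧ ∃ g : ℝ × EuclideanSpace ℝ (Fin 3) → G,
        ContDiffOn ℝ (⊤ : ℕ∞) g (Set.Ioi a ×ˢ Set.univ) ∧
        (∀ m : ℕ, ∃ C : ℝ, ∀ z ∈ Set.Ioi a ×ˢ (Set.univ : Set (EuclideanSpace ℝ (Fin 3))),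
            ‖iteratedFDeriv ℝ m g z‖ ≤ C) ∧
        ∀ (m : ℕ) (K : Set (ℝ × EuclideanSpace ℝ (Fin 3))), IsCompact K → K ⊆ Set.Ioi a ×ˢ Set.univ →
          TendstoUniformlyOn (fun n => iteratedFDeriv ℝ m (f (φ n))) (iteratedFDeriv ℝ m g) atTop K) →
    ∀ (ν : ℝ) (F : UnitAddTorus (Fin 3) → EuclideanSpace ℝ (Fin 3))
      (u : ℝ → UnitAddTorus (Fin 3) → EuclideanSpace ℝ (Fin 3)) (p : ℝ → UnitAddTorus (Fin 3) → ℝ),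
      0 < ν → IsSmooth F → IsDivFree F → HasZeroMean F →
      IsClassicalNSSolutionOn (Set.Ici 0) ν (fun _ => F) u p →
      (∀ t : ℝ, 0 ≤ t → HasZeroMean (u t)) →
      (∀ k : ℕ, ∃ C : ℝ, ∀ t : ℝ, 0 ≤ t → sobolevEnergy k (u t) ≤ C) →
      ∀ s : ℕ → ℝ, (∀ n, 0 ≤ s n) →
        ∃ φ : ℕ → ℕ, StrictMono φ ∧
          ∃ (v : ℝ → UnitAddTorus (Fin 3) → EuclideanSpace ℝ (Fin 3)) (q : ℝ → UnitAddTorus (Fin 3) → ℝ),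
          IsClassicalNSSolutionOn (Set.Ici 0) ν (fun _ => F) v q ∧ (∀ t : ℝ, 0 ≤ t → HasZeroMean (v t)) ∧
          ∀ T ε : ℝ, 0 ≤ T → 0 < ε → ∀ᶠ n in atTop, ∀ t ∈ Set.Icc 0 T,
            (∫ x, ‖u (s (φ n) + t) x - v t x‖ ^ 2) ≤ ε ∧
              gradNormSq (fun x => u (s (φ n) + t) x - v t x) ≤ ε := by
  intro hLB hAS ν F u p hν hF hdiv hmean hsol hzm hall s hs0
  -- reduce the conclusion to the `t + s` form
  suffices H : ∃ φ : ℕ → ℕ, StrictMono φ ∧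
      ∃ (v : ℝ → UnitAddTorus (Fin 3) → EuclideanSpace ℝ (Fin 3)) (q : ℝ → UnitAddTorus (Fin 3) → ℝ),
        IsClassicalNSSolutionOn (Ici 0) ν (fun _ => F) v q ∧ (∀ t : ℝ, 0 ≤ t → HasZeroMean (v t)) ∧
        ∀ T ε : ℝ, 0 ≤ T → 0 < ε → ∀ᶠ n in atTop, ∀ t ∈ Icc 0 T,
          (∫ x, ‖u (t + s (φ n)) x - v t x‖ ^ 2) ≤ ε ∧
            gradNormSq (fun x => u (t + s (φ n)) x - v t x) ≤ ε by
    obtain ⟨φ, hφ, v, q, h1, h2, h3⟩ := H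
    refine ⟨φ, hφ, v, q, h1, h2, fun T ε hT hε => ?_⟩
    filter_upwards [h3 T ε hT hε] with n hn t ht
    simpa only [add_comm (s (φ n)) t] using hn t ht
  by_cases hb : ∃ R : ℝ, ∀ n, s n ≤ R
  · obtain ⟨R, hR⟩ := hb
    exact clsC_compactLimit_of_bounded hsol hzm hs0 hR
  · -- unbounded: a subsequence with `s ≥ 1`
    push Not at hb
    have hfreq : ∀ N : ℕ, ∃ n, N ≤ n ∧ 1 ≤ s n := by
      intro N
      -- `s` is unbounded on `{n ≥ N}` since it is bounded on `{n < N}`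
      by_contra hcon
      push Not at hcon
      obtain ⟨n, hn⟩ := hb (max 1 (∑ k ∈ Finset.range N, |s k|) )
      rcases le_or_gt N n with h | h
      · have := hcon n h
        have : s n ≤ max 1 (∑ k ∈ Finset.range N, |s k|) := le_trans this.le (le_max_left _ _)
        linarith
      · have h1 : s n ≤ ∑ k ∈ Finset.range N, |s k| := by
          have hmem : n ∈ Finset.range N := Finset.mem_range.2 h
          exact (le_abs_self (s n)).trans (Finset.single_le_sum (fun k _ => abs_nonneg (s k)) hmem)
        have : s n ≤ max 1 (∑ k ∈ Finset.range N, |s k|) := h1.trans (le_max_right _ _)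
        linarith
    have hfr : ∃ᶠ n in atTop, 1 ≤ s n :=
      Filter.frequently_atTop.2 fun N => by
        obtain ⟨n, hn, h⟩ := hfreq N
        exact ⟨n, hn, h⟩
    obtain ⟨ψ, hψ, hψ1⟩ := Filter.extraction_of_frequently_atTop hfr
    obtain ⟨hbU, hbP⟩ := hLB ν F u p hν hF hdiv hmean hsol hzm hall
    obtain ⟨φ, hφ, v, q, h1, h2, h3⟩ :=
      clsB_compactLimit_of_unbounded hAS hsol hzm hbU hbP (s := fun n => s (ψ n)) hψ1
    exact ⟨ψ ∘ φ, hψ.comp hφ, v, q, h1, h2, h3⟩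

end Summit.AnomalousDissipation.AnomalousDissipation.Theorems.ChainRealisation.SeparatrixFluxPinning

end
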